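import Summits.MatrixMultiplication.MatrixMultiplication.Theses.ModularHeisenberg
import Literature.Computability.AlgebraicComplexity.AsymptoticRankMultiples
import Literature.Computability.AlgebraicComplexity.AsymptoticRankBorderRank

/-!
# Crux `ModularHeisenbergMinimal` (stmt-MatrixMultiplication-4349) — `Lines/birth.lean`, the BC3 birth skeleton

Route `ModularHeisenberg` (route-MatrixMultiplication-ModularHeisenberg; deciding theorem
`closes : HeisenbergLowerFrame → CharacteristicLift → ModularHeisenbergMinimal → MatrixMultiplication`,
proved in the route file).  The crux, with `T_p` the multiplication table of the Heisenberg group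
`H_p = U₃(ℤ/p)` on `Fin p × Fin p × Fin p` (law `(a,b,c)·(a',b',c') = (a+a', b+b', c+c'+ab')`) read over
`𝔽̄_p = AlgebraicClosure (ZMod p)`, i.e. the structure tensor of the LOCAL algebra `𝔽̄_p[H_p]`:

  `ModularHeisenbergMinimal : ∀ ε > 0, ∃ p₀, ∀ primes p ≥ p₀, R̃_{𝔽̄_p}(T_p) ≤ p^(3+ε)`

(the asymptotic rank conjecture over `𝔽̄_p` for this one family of concise `p³ × p³ × p³` tensors,
with sub-polynomial slack; `p³ ≤ R̃(T_p)` in every characteristic, `≤ p⁴` by QuarticCalibration).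

## The line (`birth`): minimality RELATIVE TO THE CENTRE — central-character deformation

The centre `Z = {(0,0,c)} ≅ ℤ/p` of `H_p` makes `A := 𝔽̄_p[H_p]` a free algebra of rank `p²` over the
local ring `R := 𝔽̄_p[Z] ≅ 𝔽̄_p[t]/(t^p)` (`t = z - 1`), with commutative special fibre
`A/tA = 𝔽̄_p[H_p/Z] = 𝔽̄_p[u,v]/(u^p,v^p)` (asymptotically minimal: `R̃ = p²`) and the non-commutativity
confined to the unipotent central twist `xy = z·yx`, `z = 1 + t`, `t^p = 0`.  Over `ℂ` the same
relative picture splits along the `p` central characters into `ℂ[(ℤ/p)²] ⊕ M_p(ℂ)^{⊕(p-1)}` — this is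
where `ω` enters the route — and "cheap relative to the centre" is there EQUIVALENT to `ω = 2`; over
`𝔽̄_p` the central parameter cannot be diagonalised (`z^p = 1 ⇒ z = 1`), it can only be EXPANDED IN,
order by order in the nilpotent `t`: near-minimal schemes of the commutative quotient
`𝔽̄_p[(ℤ/p)^{2n}]` (they exist: `R̃(𝔽̄_p[ℤ/p]) = p`) are to be Hensel-lifted along `t₁, …, t_n` to
`R^{⊗n}`-bilinear schemes of `A^{⊗n}` — the route's own lifting calculus (card
hensel-rees-obstruction-calculus, foreseen for `CharacteristicLift` along `p`) run in EQUAL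
characteristic along the centre, where the base `𝔽̄_p[t]/(t^p)` is Artinian and every obstruction is a
finite, checkable linear condition.  An `R^{⊗n}`-bilinear scheme with `r` products for `A^{⊗n}` is,
read over `𝔽̄_p`, a RESTRICTION `T_p^{⊠n} ≤ ⟨r⟩ ⊠ Z_p^{⊠n}` from `r` independent copies of the
multiplication tensor `Z_p^{⊠n}` of `R^{⊗n} = 𝔽̄_p[(ℤ/p)^n]` (`Z_p z x y = [x + y = z]` on `Fin p`, the
modular CYCLIC table); so the crux splits as

* `stub_centralSchemes` — **the engine** (XL / open; the crux in relative currency, STRONGER than it):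
  for every `ε > 0` and all large primes `p` some Kronecker power `T_p^{⊠n}` (`n ≥ 1`) is a restriction of
  `⟨r⟩ ⊠ Z_p^{⊠n}` with `r ≤ p^{(2+ε)n}`.  Why plausibly true: (i) the ABELIAN model holds — for
  `(ℤ/p)³ ⊃ ℤ/p` the statement reads `Z_p^{⊠3n} ≤ ⟨R(Z_p^{⊠2n})⟩ ⊠ Z_p^{⊠n}` with
  `R(Z_p^{⊠2n}) ≤ p^{(2+ε)n}` for large `n` (`R̃(Z_p) = p`, stub 2); (ii) at level `n = 1` the coset
  presentation gives `r ≤ p²(2p-1)` (the relative form of QuarticCalibration's `p⁴`), so the statement is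
  exactly "beat the skew-polynomial presentation asymptotically, linearly over the centre"; (iii) it is
  the characteristic-`p` fibre of a relative scheme over `ℤ[z]/(z^p - 1)` whose complex fibres are the
  `⟨p,p,p⟩`-schemes the thesis is about.  Why it might fail: it is stronger than the crux by the
  subrank deficiency of `Z_p` (`Q̃(Z_p) < p`, so `⟨p^{(3+ε)n}⟩ ≰ ⟨p^{(2+ε)n}⟩ ⊠ Z_p^{⊠n}` and an absolute
  near-minimal scheme does NOT give a relative one); first-order Hensel obstructions (the Poisson
  direction `{u,v} = uv` must be tangent to the secant variety at the chosen scheme of the quotient) may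
  survive all paddings.  Sources: BurgisserClausenShokrollahi1997 (§2.2 (2.6)–(2.7): bilinear algorithms
  relative to a coefficient ring; Problem 15.5; Ex. 15.9), CohnUmans2003, arXiv:2212.01175 §5 (Hensel
  lifting of schemes fails at finite level for ⟨4,4,4⟩ over ℤ/4 — the kind of obstruction to expect),
  doi:10.1016/0021-8693(68)90069-0 (Jennings–Quillen: `gr 𝔽̄_p[H_p]`), BlaserLysikov2016 (why level 1
  cannot be minimal: unital non-commutative ⇒ `bR > dim`, also relative to `R`).
* `stub_cyclicCalibration` — **the calibration** (M, PROVABLE NOW): `bR_{𝔽̄_p}(Z_p) ≤ p`, the border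
  rank over `𝔽̄_p[ε]` (Bläser 2013 Def. 6.1 = `algBorderRank`) of the modular cyclic table, i.e. of
  `𝔽̄_p[ℤ/p] ≅ 𝔽̄_p[t]/(t^p)`.  Proof to port: BurgisserClausenShokrollahi1997 Ex. 15.9 (PDF p. 448; works
  over ANY field, unlike Example (15.20) which needs a primitive `p`-th root of unity that `𝔽̄_p` lacks):
  `𝔽̄_p(ε)[t]/(f)`, `f = t(t-ε)(t-ε²)⋯(t-ε^{p-1})` (or `f = t^p - ε^{p-1}t = ∏_{a ∈ 𝔽_p}(t - aε)`) has rank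
  `p` by Lagrange interpolation and approximates `𝔽̄_p[t]/(t^p)` to order `O(p²)`; compose with the algebra
  isomorphism `z ↦ 1 + t` (border rank is a `GL³`-invariant).  It is the `p`-uniform char-`p` input every
  statement of the route uses (QuarticCalibration is its two-variable twisted form).  Sources:
  BurgisserClausenShokrollahi1997 (Ex. 15.9, Example (15.20), Lemma (15.27)), Blaser2013 (Def. 6.1,
  Thm. 6.6), AlderStrassen1981 (`R = 2p - 1` at level 1: rank alone would only give `(2p-1)^n`).
* Sorry-free core (any field `K`, any tensors): `pow_asymptoticRank_le_kroneckerPow`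
  (`R̃(t)^k ≤ R̃(t^{⊠k})`, from the infimum), `pow_asymptoticRank_le_of_centralScheme`
  (`t^{⊠n} ≤ ⟨r⟩ ⊠ g^{⊠n} ⇒ R̃(t)^n ≤ r·R̃(g)^n`: degeneration-monotonicity
  `asymptoticRank_le_of_polyDegeneratesTo`, `asymptoticRank_multiple_le` (`R̃(⟨r⟩ ⊠ s) ≤ r R̃(s)`),
  `asymptoticRank_kroneckerPow_le`), and `modularHeisenbergMinimal_of_hyps` — the composition with the two
  stub signatures as EXPLICIT hypotheses, concluding the crux body verbatim:
  `R̃(T_p)^n ≤ r · R̃(Z_p)^n ≤ p^{(2+ε)n} · (bR(Z_p))^n ≤ p^{(2+ε)n} p^n = (p^{3+ε})^n`, take `n`-th roots.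
* `ModularHeisenbergMinimal_of : ModularHeisenbergMinimal` — THE skeleton theorem (the file's only theorem
  whose head is the crux name): the crux BY NAME from the two declared stubs, the only `sorry`s here.

Honest status.  Stub 2 is a true lemma (BCS Ex. 15.9).  Stub 1 is STRONGER than the crux (relative ⇒
absolute by stub 2 and the core; the converse fails by the subrank deficiency of `Z_p`), so this skeleton
is a genuine bet, not a currency change: it localises all the difficulty of `ModularHeisenbergMinimal` in
the ONE place where `𝔽̄_p[H_p]` differs from the minimal `𝔽̄_p[(ℤ/p)³]` — the central twist `z^{ab'}`,
`z = 1 + t`, `t^p = 0` — and hands provers a finite deformation/lifting problem over `𝔽̄_p[t]/(t^p)` with a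
true abelian model and a level-1 value (`p²(2p-1)`) to beat.  The route header's foreseen children
(LazardModel `𝔽̄_p[H_p] ≅? u(𝔥_p)`, StarProductMinimality) are NOT used: the Lazard isomorphism is
unverified even at `p = 3` and is not needed once one works relative to `Z` instead of relative to a PBW
basis.  Disproof used: none exists — `ledger crux ls stmt-MatrixMultiplication-4349` shows no workfiles
(no `Disproof.lean`, no `Negative/` lemma) and `ledger negatives --problem MatrixMultiplication` (7 entries,
2026-08-17) has no statement about `T_p`, `Z_p` or modular group algebras, so no `_false_without_`
obligation applies; the refuter's crux-attack evidence (2026-08-15: `mh_of_arc`, `cube_le_asymptoticRank_heis`,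
`not_mh_neg_eps`) is positive-side knowledge consistent with both stubs (`0 < ε` stays load-bearing: at
`ε ≤ 0` stub 1 would force `R̃(T_p) ≤ p³·`const, and the engine is only claimed asymptotically in `n`).
Kill inherited from the route: `R̃_{𝔽̄_p}(T_p) ≥ p^{3+c}` along infinitely many primes refutes stub 1 and the
crux together; a relative-only kill (stub 1 false, crux open) would itself be new: a restriction
obstruction in characteristic `p` beyond flattenings.

BC3 probes (planner-run 2026-08-17, `lean check`, each `first | exact? | simpa | aesop` under
`maxHeartbeats 400000`, files `bc/probe_*.lean` in the planner folder): `stub_centralSchemes → ModularHeisenbergMinimal`,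
`stub_centralSchemes → MatrixMultiplication`, `stub_cyclicCalibration → ModularHeisenbergMinimal`,
`stub_cyclicCalibration → MatrixMultiplication` — all FAIL (verdicts quoted in `Lines/birth.md`).
-/

-- `Summit.<Summit>.<Problem>`: for the single-conjunct summit the duplicate component is mandated.
set_option linter.dupNamespace false

noncomputable section

namespace Summit.MatrixMultiplication.MatrixMultiplication.Cruxes.ModularHeisenbergMinimal.Birth

open Literature.Computability.AlgebraicComplexity
open Literature.Barriers.MatrixMultiplication (asymptoticRank_le_of_polyDegeneratesTo
  asymptoticRank_le_rpow tensorRank_kroneckerPow_mul asymptoticRank_kroneckerPow_le)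
open Summit.MatrixMultiplication.MatrixMultiplication.Theses.ModularHeisenberg (ModularHeisenbergMinimal)

/-! ## The two registered stubs -/

/-- **Stub 1 — central schemes (the engine).**  For every `ε > 0` and all sufficiently large primes `p`,
some Kronecker power `T_p^{⊠n}` (`n ≥ 1`) of the modular Heisenberg table is a restriction of `r ≤ p^{(2+ε)n}`
independent copies of the `n`-th Kronecker power of the modular cyclic table `Z_p z x y = [x + y = z]`
(the multiplication tensor of `𝔽̄_p[(ℤ/p)^n] = R^{⊗n}`, `R = 𝔽̄_p[Z(H_p)]`): `⟨r⟩ ⊠ Z_p^{⊠n} ≥ T_p^{⊠n}`.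
Equivalently-in-spirit: `A^{⊗n} = 𝔽̄_p[H_p^n]` has an `R^{⊗n}`-bilinear multiplication scheme with
`p^{(2+ε)n}` products for large `n` — the Heisenberg group algebra is asymptotically minimal RELATIVE TO ITS
CENTRE.  True in the abelian model `(ℤ/p)³ ⊃ ℤ/p`; level-1 value `r ≤ p²(2p-1)`; stronger than the crux
(relative ⇒ absolute via stub 2, not conversely).  Size XL / open.  Sources: BurgisserClausenShokrollahi1997
(§2.2, Problem 15.5, Ex. 15.9), CohnUmans2003, arXiv:2212.01175 (§5), doi:10.1016/0021-8693(68)90069-0,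
BlaserLysikov2016. -/
theorem stub_centralSchemes :
    ∀ ε : ℝ, 0 < ε → ∃ p₀ : ℕ, ∀ (p : ℕ) [Fact p.Prime], p₀ ≤ p → ∃ n : ℕ, 1 ≤ n ∧ ∃ r : ℕ,
      (r : ℝ) ≤ (p : ℝ) ^ ((2 + ε) * (n : ℝ)) ∧
      Literature.Computability.AlgebraicComplexity.TensorRestrictsTo
        (Literature.Computability.AlgebraicComplexity.kroneckerTensor
          (Literature.Computability.AlgebraicComplexity.unitTensor (AlgebraicClosure (ZMod p)) r)
          (Literature.Computability.AlgebraicComplexity.kroneckerPow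
            (fun z x y : Fin p => if x + y = z then (1 : AlgebraicClosure (ZMod p)) else 0) n))
        (Literature.Computability.AlgebraicComplexity.kroneckerPow
          (fun z x y : Fin p × Fin p × Fin p =>
            if x.1 + y.1 = z.1 ∧ x.2.1 + y.2.1 = z.2.1 ∧ x.2.2 + y.2.2 + x.1 * y.2.1 = z.2.2
            then (1 : AlgebraicClosure (ZMod p)) else 0) n) := by
  sorry

/-- **Stub 2 — cyclic calibration (provable now).**  The modular cyclic table `Z_p z x y = [x + y = z]` on
`Fin p` — the structure tensor of `𝔽̄_p[ℤ/p] ≅ 𝔽̄_p[t]/(t^p)` — has border rank at most `p` over `𝔽̄_p[ε]`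
(Bläser 2013, Def. 6.1; hence exactly `p`, and `R̃(Z_p) = p`).  Proof to port: BCS Ex. 15.9 —
`f = ∏_{a ∈ 𝔽_p} (t - aε) = t^p - ε^{p-1} t` is separable over `𝔽̄_p(ε)`, Lagrange interpolation at the `p`
points `aε` gives an order-`O(p²)` approximate decomposition with `p` triads of `𝔽̄_p[t]/(t^p)`, and
`z ↦ 1 + t` is an algebra isomorphism `𝔽̄_p[ℤ/p] ≅ 𝔽̄_p[t]/(t^p)` (Example (15.20) does NOT apply: `𝔽̄_p` has
no primitive `p`-th root of unity).  Size M.  Sources: BurgisserClausenShokrollahi1997 (Ex. 15.9,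
Example (15.20), Lemma (15.27)), Blaser2013 (Def. 6.1, Thm. 6.6), AlderStrassen1981. -/
theorem stub_cyclicCalibration :
    ∀ (p : ℕ) [Fact p.Prime],
      Literature.Computability.AlgebraicComplexity.algBorderRank
        (fun z x y : Fin p => if x + y = z then (1 : AlgebraicClosure (ZMod p)) else 0) ≤ p := by
  sorry

/-! ## Sorry-free core (any field, any tensors) -/

/-- **`R̃(t)^k ≤ R̃(t^{⊠k})`** (`k ≥ 1`): from the infimum, `R̃(t) ≤ R(t^{⊠(Nk)})^{1/(Nk)} =
(R((t^{⊠k})^{⊠N})^{1/N})^{1/k}` for every `N ≥ 1` (Christandl–Vrana–Zuiddam 2023, §1.1; same proof as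
`Theorems/AsymptoticRankCWBPerm3Form.pow_asymptoticRank_le_asymptoticRank_kroneckerPow`, copied to keep this
workfile free of cross-route imports). [folklore] -/
theorem pow_asymptoticRank_le_kroneckerPow {K : Type*} [Field K] {ι κ μ : Type*} [Fintype ι] [Fintype κ]
    [Fintype μ] (t : ι → κ → μ → K) {k : ℕ} (hk : 0 < k) :
    asymptoticRank t ^ k ≤ asymptoticRank (kroneckerPow t k) := by
  have h0 : 0 ≤ asymptoticRank t := asymptoticRank_nonneg t
  have hk0 : (k : ℝ) ≠ 0 := by exact_mod_cast hk.ne'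
  refine le_ciInf fun N => ?_
  have hkN : 0 < (N + 1) * k := Nat.mul_pos (Nat.succ_pos N) hk
  have h1 := asymptoticRank_le_rpow t hkN
  rw [tensorRank_kroneckerPow_mul t (N + 1) k] at h1
  calc asymptoticRank t ^ k
      ≤ (((tensorRank (kroneckerPow (kroneckerPow t k) (N + 1)) : ℝ)) ^
          ((((N + 1) * k : ℕ) : ℝ))⁻¹) ^ k := pow_le_pow_left₀ h0 h1 k
    _ = (tensorRank (kroneckerPow (kroneckerPow t k) (N + 1)) : ℝ) ^ ((N : ℝ) + 1)⁻¹ := by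
        rw [← Real.rpow_natCast, ← Real.rpow_mul (Nat.cast_nonneg _)]
        congr 1
        push_cast
        rw [mul_inv, inv_mul_cancel_right₀ hk0]

/-- **Relative ⇒ absolute** (the BC3 shape for ANY tensors `t`, `g` over any field): a central scheme
`⟨r⟩ ⊠ g^{⊠n} ≥ t^{⊠n}` (`n ≥ 1`) gives `R̃(t)^n ≤ r · R̃(g)^n`.  Proof: `R̃(t)^n ≤ R̃(t^{⊠n})`
(`pow_asymptoticRank_le_kroneckerPow`) `≤ R̃(⟨r⟩ ⊠ g^{⊠n})` (a restriction is a degeneration, `R̃` is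
degeneration-monotone) `≤ r · R̃(g^{⊠n})` (`asymptoticRank_multiple_le`) `≤ r · R̃(g)^n`
(`asymptoticRank_kroneckerPow_le`). [folklore] -/
theorem pow_asymptoticRank_le_of_centralScheme {K : Type} [Field K] {ι κ μ ι' κ' μ' : Type}
    [Fintype ι] [Fintype κ] [Fintype μ] [Fintype ι'] [Fintype κ'] [Fintype μ']
    [DecidableEq ι] [DecidableEq κ] [DecidableEq μ] [DecidableEq ι'] [DecidableEq κ'] [DecidableEq μ']
    (t : ι → κ → μ → K) (g : ι' → κ' → μ' → K) {n : ℕ} (hn : 0 < n) (r : ℕ)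
    (hres : TensorRestrictsTo (kroneckerTensor (unitTensor K r) (kroneckerPow g n)) (kroneckerPow t n)) :
    asymptoticRank t ^ n ≤ r * asymptoticRank g ^ n :=
  calc asymptoticRank t ^ n ≤ asymptoticRank (kroneckerPow t n) := pow_asymptoticRank_le_kroneckerPow t hn
    _ ≤ asymptoticRank (kroneckerTensor (unitTensor K r) (kroneckerPow g n)) :=
        asymptoticRank_le_of_polyDegeneratesTo hres.polyDegeneratesTo
    _ ≤ r * asymptoticRank (kroneckerPow g n) := asymptoticRank_multiple_le K r _
    _ ≤ r * asymptoticRank g ^ n :=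
        mul_le_mul_of_nonneg_left (asymptoticRank_kroneckerPow_le g hn) (Nat.cast_nonneg _)

/-! ## The composition with explicit hypotheses -/

/-- **Composition** (stub signatures as EXPLICIT hypotheses; conclusion = the crux body verbatim, so that
`ModularHeisenbergMinimal_of` below is the file's only theorem whose head is the crux name).  Given `ε > 0`
take `p₀` from the central schemes; for a prime `p ≥ p₀` with its `n ≥ 1`, `r ≤ p^{(2+ε)n}` and
`⟨r⟩ ⊠ Z_p^{⊠n} ≥ T_p^{⊠n}`: `R̃(T_p)^n ≤ r · R̃(Z_p)^n ≤ p^{(2+ε)n} · p^n = (p^{3+ε})^n`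
(`R̃(Z_p) ≤ bR(Z_p) ≤ p`, BCS Lemma (15.27)), and `n`-th roots are monotone. [folklore] -/
theorem modularHeisenbergMinimal_of_hyps
    (h₁ : ∀ ε : ℝ, 0 < ε → ∃ p₀ : ℕ, ∀ (p : ℕ) [Fact p.Prime], p₀ ≤ p → ∃ n : ℕ, 1 ≤ n ∧ ∃ r : ℕ,
      (r : ℝ) ≤ (p : ℝ) ^ ((2 + ε) * (n : ℝ)) ∧
      Literature.Computability.AlgebraicComplexity.TensorRestrictsTo
        (Literature.Computability.AlgebraicComplexity.kroneckerTensor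
          (Literature.Computability.AlgebraicComplexity.unitTensor (AlgebraicClosure (ZMod p)) r)
          (Literature.Computability.AlgebraicComplexity.kroneckerPow
            (fun z x y : Fin p => if x + y = z then (1 : AlgebraicClosure (ZMod p)) else 0) n))
        (Literature.Computability.AlgebraicComplexity.kroneckerPow
          (fun z x y : Fin p × Fin p × Fin p =>
            if x.1 + y.1 = z.1 ∧ x.2.1 + y.2.1 = z.2.1 ∧ x.2.2 + y.2.2 + x.1 * y.2.1 = z.2.2
            then (1 : AlgebraicClosure (ZMod p)) else 0) n))
    (h₂ : ∀ (p : ℕ) [Fact p.Prime],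
      Literature.Computability.AlgebraicComplexity.algBorderRank
        (fun z x y : Fin p => if x + y = z then (1 : AlgebraicClosure (ZMod p)) else 0) ≤ p) :
    ∀ ε : ℝ, 0 < ε → ∃ p₀ : ℕ, ∀ (p : ℕ) [Fact p.Prime], p₀ ≤ p →
      Literature.Computability.AlgebraicComplexity.asymptoticRank
        (fun z x y : Fin p × Fin p × Fin p =>
          if x.1 + y.1 = z.1 ∧ x.2.1 + y.2.1 = z.2.1 ∧ x.2.2 + y.2.2 + x.1 * y.2.1 = z.2.2
          then (1 : AlgebraicClosure (ZMod p)) else 0) ≤ (p : ℝ) ^ (3 + ε) := by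
  intro ε hε
  obtain ⟨p₀, hp₀⟩ := h₁ ε hε
  refine ⟨p₀, fun p _ hp => ?_⟩
  obtain ⟨n, hn, r, hr, hres⟩ := hp₀ p hp
  have hn0 : 0 < n := hn
  -- the two tensors at this prime
  set T : (Fin p × Fin p × Fin p) → (Fin p × Fin p × Fin p) → (Fin p × Fin p × Fin p) →
      AlgebraicClosure (ZMod p) := fun z x y =>
    if x.1 + y.1 = z.1 ∧ x.2.1 + y.2.1 = z.2.1 ∧ x.2.2 + y.2.2 + x.1 * y.2.1 = z.2.2
    then (1 : AlgebraicClosure (ZMod p)) else 0 with hT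
  set G : Fin p → Fin p → Fin p → AlgebraicClosure (ZMod p) :=
    fun z x y => if x + y = z then (1 : AlgebraicClosure (ZMod p)) else 0 with hG
  -- relative ⇒ absolute
  have key : asymptoticRank T ^ n ≤ r * asymptoticRank G ^ n :=
    pow_asymptoticRank_le_of_centralScheme T G hn0 r hres
  -- calibration: `R̃(Z_p) ≤ bR(Z_p) ≤ p`
  have hGp : asymptoticRank G ≤ (p : ℝ) := asymptoticRank_le_of_algBorderRank_le (h₂ p)
  have hG0 : 0 ≤ asymptoticRank G := asymptoticRank_nonneg G
  have hp2 : (2 : ℝ) ≤ (p : ℝ) := by exact_mod_cast (Fact.out : p.Prime).two_le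
  have hppos : (0 : ℝ) < (p : ℝ) := by linarith
  have h1 : asymptoticRank T ^ n ≤ ((p : ℝ) ^ (3 + ε)) ^ n :=
    calc asymptoticRank T ^ n ≤ r * asymptoticRank G ^ n := key
      _ ≤ (p : ℝ) ^ ((2 + ε) * (n : ℝ)) * (p : ℝ) ^ n :=
          mul_le_mul hr (pow_le_pow_left₀ hG0 hGp n) (by positivity) (by positivity)
      _ = ((p : ℝ) ^ (3 + ε)) ^ n := by
          rw [← Real.rpow_natCast (p : ℝ) n, ← Real.rpow_add hppos, ← Real.rpow_mul_natCast hppos.le]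
          congr 1
          ring
  exact le_of_pow_le_pow_left₀ hn0.ne' (by positivity) h1

/-! ## The skeleton theorem: the two stubs prove the crux BY NAME -/

/-- `ModularHeisenbergMinimal` is, character for character, the conclusion of
`modularHeisenbergMinimal_of_hyps` (route file `Theses/ModularHeisenberg.lean`). [folklore] -/
theorem modularHeisenbergMinimal_iff :
    ModularHeisenbergMinimal ↔
      ∀ ε : ℝ, 0 < ε → ∃ p₀ : ℕ, ∀ (p : ℕ) [Fact p.Prime], p₀ ≤ p →
        Literature.Computability.AlgebraicComplexity.asymptoticRank
          (fun z x y : Fin p × Fin p × Fin p =>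
            if x.1 + y.1 = z.1 ∧ x.2.1 + y.2.1 = z.2.1 ∧ x.2.2 + y.2.2 + x.1 * y.2.1 = z.2.2
            then (1 : AlgebraicClosure (ZMod p)) else 0) ≤ (p : ℝ) ^ (3 + ε) :=
  Iff.rfl

/-- **THE SKELETON THEOREM.** The crux
`Summit.MatrixMultiplication.MatrixMultiplication.Theses.ModularHeisenberg.ModularHeisenbergMinimal`
(stmt-MatrixMultiplication-4349), concluded BY NAME from the two DECLARED stubs `stub_centralSchemes`
(engine) and `stub_cyclicCalibration` (calibration) — the only `sorry`s of the file — through the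
sorry-free composition `modularHeisenbergMinimal_of_hyps` and the `Iff.rfl` bridge. [folklore] -/
theorem ModularHeisenbergMinimal_of :
    Summit.MatrixMultiplication.MatrixMultiplication.Theses.ModularHeisenberg.ModularHeisenbergMinimal :=
  modularHeisenbergMinimal_iff.mpr
    (modularHeisenbergMinimal_of_hyps stub_centralSchemes stub_cyclicCalibration)

end Summit.MatrixMultiplication.MatrixMultiplication.Cruxes.ModularHeisenbergMinimal.Birth

end
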